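import Literature.MathematicalPhysics.QuantumLattice.TranslationInvariantGroundStatesAreMeanEnergyMinimisers
import Literature.MathematicalPhysics.QuantumLattice.PeriodicStatesCellAverage
import HarnessLib

/-!
# Superlattice-periodic interactions and states: site energies, the cell-averaged energy density, and the free-boundary
# energy bookkeeping `|Re ω(H_Λ) − Re(Ψ∅) − n^d ē(ω)| ≤ col_R(Λ)·S` on aligned boxes

Topic `Literature/MathematicalPhysics/QuantumLattice` (family `hubbard`; crew hubbard-fast S2/S3 «families of models: multi-band by decoration,
bilayer/trilayer stackings, staggered fields — all SUPERLATTICE-PERIODIC, not translation invariant»). The thermodynamic formalism of the tree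
(`TIVariationalPressure`, `FermionGibbsVariationalPrinciple`) is written for translation-COVARIANT interactions. This file starts its periodic
twin with the energy side: for an interaction `Ψ` and a state `ω` of the lattice fermions on `ℤ^d` that are only covariant / invariant under
the rectangular superlattice `L_q = ⊕_i (q_i+1)ℤe_i` (`FermionInteraction.IsPeriodic q`, `InfVolFermionState.IsPeriodic q`):

* §1 lattice vectors `superlatVec q z = Σ_i z_i (q_i+1) e_i`; periodic states absorb them (`IsPeriodic.shift_superlatVec`); periodic interactions
  (`FermionInteraction.IsPeriodic`, translation invariant ⇒ periodic); the term energies are superlattice invariant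
  (`expect_apply_shiftSet_superlatVec`).
* §2 the SITE ENERGY `siteEnergy Ψ R ω x = Σ_{Y ∋ x, Y ⊆ thicken{x} R} |Y|⁻¹ ω_Y(Ψ Y)` (for translation-invariant data this is `ω(E_Ψ)`,
  `IsTranslationInvariant.siteEnergy_eq`), superlattice periodic for periodic data (`siteEnergy_add_superlatVec`), bounded by the uniform interaction
  norm (`norm_siteEnergy_le`); the GENERIC bookkeeping identity, valid for every state and every finite-range interaction:
  `Σ_{x ∈ Λ} siteEnergy x − (ω(H_Λ) − ω(Ψ∅)) = Σ_{Y ⊆ thicken Λ R, Y ⊄ Λ} |Y∩Λ| |Y|⁻¹ ω(Ψ Y)` (`sum_siteEnergy_sub_eq`), with the collar bound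
  `‖…‖ ≤ |thicken_R Λ ∖ Λ|·S` under a UNIFORM SITE NORM `Σ_{X ∋ y, X ⊆ thicken{y} R} ‖Ψ X‖ ≤ S` (`norm_sum_siteEnergy_sub_le`).
* §3 the CELL ENERGY DENSITY `cellMeanEnergy q Ψ R ω = |C|⁻¹ Σ_{c ∈ C} Re siteEnergy (pos c)`; for translation-invariant `Ψ` it is the mean
  energy of the cell average (`cellMeanEnergy_eq_meanEnergy_cellAverage`); counting residues in aligned boxes
  (`card_filter_halfOpenBox_cellRes_eq`) gives **`IsPeriodic.sum_re_siteEnergy_halfOpenBox_eq`: `Σ_{x ∈ [0,n)^d} Re siteEnergy x = n^d · ē(ω)`** for `q`-periodic data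
  and `(q_i+1) ∣ n`, hence **`IsPeriodic.abs_pow_mul_cellMeanEnergy_sub_le`: `|n^d ē(ω) − (Re ω(H_{[0,n)^d}) − Re(Ψ∅)_{∅∅})| ≤ col_R(n)·S`**.

Everything is PROVED; definitions with bodies: `superlatVec`, `FermionInteraction.IsPeriodic`, `siteEnergy`, `cellMeanEnergy`, `cellRes` (the uniform site
norm `S` is a hypothesis; `IsTranslationInvariant.site_norm_le` / `IsPeriodic.site_norm_le` supply it). No named fact, no number.

## Tree / Mathlib search

REUSED: `IsPeriodic`, `periodVec`, `Cell`, `cellPos`, `cellAverage`, `shiftAverage_expect`, `meanEnergy_cellAverage` (`PeriodicStatesCellAverage`);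
`sum_sum_filter_mem_eq_sum_card_inter_smul`, `HasFiniteRange.sum_filter_mem_eq_sum_thicken_singleton`, `sum_thicken_singleton_eq_sum_shiftSet`,
`expect_localHamiltonian_eq_sum`, `norm_sum_filter_not_subset_le`, `sum_filter_not_subset_le_sum_sdiff_sum`,
`IsTranslationInvariant.sum_filter_mem_card_inv_mul_expect_eq`, `thicken_subset_thicken_of_subset` (`TranslationInvariantGroundStatesAreMeanEnergyMinimisers`);
`shift_expect`, `shift_shift`, `shift_zero`, `norm_expect_le`; Mathlib `Int.emod_emod_of_dvd`, `Finset.card_eq_of_equiv`.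

## References

* O. Bratteli, D. W. Robinson, *OAQSM 2* (1997), §6.2.4 (mean energy, surface terms). [cite: BratteliRobinsonII1997, §6.2.4 (Prop. 6.2.39 ff.)]
* O. Bratteli, A. Kishimoto, D. W. Robinson, CMP 64 (1978) 41, §3 (`H̃_Φ(Λ)`, `W_Φ(Λ)`). [cite: BratteliKishimotoRobinson1978, §3 (H̃_Φ(Λ), W_Φ(Λ), p. 47)]
* H. Araki, H. Moriya, Rev. Math. Phys. 15 (2003) 93, §4.1 Def. 4.3/4.5 (translations, periodic = invariant under a subgroup), §5.4, §8.
  [cite: ArakiMoriya2003, §4.1 Def. 4.5]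
* R. B. Israel, *Convexity in the Theory of Lattice Gases* (1979), §I.1 (periodic interactions via enlarged cells). [cite: Israel1979, Thm. I.2.4]
-/

noncomputable section

open scoped ComplexOrder BigOperators Matrix.Norms.L2Operator
open Finset

namespace Literature.MathematicalPhysics.QuantumLattice

open Matrix HubbardWave0 Literature.Probability.LatticeModels ThermodynamicLimit

variable {d : ℕ}

/-! ### §1. Superlattice vectors; periodic states and interactions -/

/-- **The superlattice vector with integer coordinates `z`**: `Σ_i z_i (q_i+1) e_i`. [cite: ArakiMoriya2003, §4.1 Def. 4.3] -/
def superlatVec (q : Fin d → ℕ) (z : Fin d → ℤ) : Site d := fun i => z i * ((q i : ℤ) + 1)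

/-- Coordinates of a superlattice vector. [cite: ArakiMoriya2003, §4.1] -/
@[simp] theorem superlatVec_apply (q : Fin d → ℕ) (z : Fin d → ℤ) (i : Fin d) : superlatVec q z i = z i * ((q i : ℤ) + 1) := rfl

/-- `superlatVec` is additive. [cite: ArakiMoriya2003, §4.1] -/
theorem superlatVec_add (q : Fin d → ℕ) (z z' : Fin d → ℤ) : superlatVec q (z + z') = superlatVec q z + superlatVec q z' := by
  funext i; simp only [superlatVec_apply, Pi.add_apply]; ring

/-- `superlatVec q 0 = 0`. [cite: ArakiMoriya2003, §4.1] -/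
@[simp] theorem superlatVec_zero (q : Fin d → ℕ) : superlatVec q 0 = 0 := by
  funext i; simp only [superlatVec_apply, Pi.zero_apply, zero_mul]

/-- A superlattice vector is the integer combination of the period vectors. [cite: ArakiMoriya2003, §4.1] -/
theorem superlatVec_eq_sum (q : Fin d → ℕ) (z : Fin d → ℤ) : superlatVec q z = ∑ i, z i • periodVec q i := by
  funext j
  rw [Finset.sum_apply, Finset.sum_eq_single j]
  · rw [Pi.smul_apply, periodVec, Pi.single_eq_same, smul_eq_mul, superlatVec_apply]
  · intro i _ hij
    rw [Pi.smul_apply, periodVec, Pi.single_eq_of_ne (Ne.symm hij), smul_zero]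
  · intro hj; exact absurd (Finset.mem_univ j) hj

/-- Composition of set translations. [folklore] -/
private theorem shiftSet_shiftSet'' (a b : Site d) (A : Finset (Site d)) : shiftSet b (shiftSet a A) = shiftSet (a + b) A := by
  ext y
  simp only [mem_shiftSet]
  rw [show y - (a + b) = y - b - a by abel]

namespace InfVolFermionState

/-- **A periodic state absorbs every superlattice vector**: `ω ∘ τ_{superlatVec z} = ω`. [cite: ArakiMoriya2003, §4.1 Def. 4.5] -/
theorem IsPeriodic.shift_superlatVec {q : Fin d → ℕ} {ω : InfVolFermionState d} (hω : ω.IsPeriodic q) (z : Fin d → ℤ) :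
    ω.shift (superlatVec q z) = ω := by
  have hneg : ∀ i : Fin d, ω.shift (-periodVec q i) = ω := by
    intro i
    conv_lhs => rw [← hω i]
    rw [shift_shift, neg_add_cancel, shift_zero]
  have hz : ∀ (i : Fin d) (k : ℤ), ω.shift (k • periodVec q i) = ω := by
    intro i k
    induction k using Int.induction_on with
    | zero => rw [zero_smul, shift_zero]
    | succ k ih => rw [add_smul, one_smul, ← shift_shift, hω i, ih]
    | pred k ih => rw [sub_eq_add_neg, add_smul, neg_one_smul, ← shift_shift, hneg i, ih]
  have hsum : ∀ s : Finset (Fin d), ω.shift (∑ i ∈ s, z i • periodVec q i) = ω := by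
    intro s
    induction s using Finset.induction_on with
    | empty => rw [Finset.sum_empty, shift_zero]
    | insert a s ha ih => rw [Finset.sum_insert ha, add_comm, ← shift_shift, hz a, ih]
  rw [superlatVec_eq_sum]
  exact hsum Finset.univ

/-- For a periodic state the expectation of a translated observable by a superlattice vector is the original expectation.
[cite: ArakiMoriya2003, §4.1 Def. 4.5] -/
theorem IsPeriodic.expect_shiftSet_superlatVec {q : Fin d → ℕ} {ω : InfVolFermionState d} (hω : ω.IsPeriodic q) (z : Fin d → ℤ)
    (Λ : Finset (Site d)) (A : FermionOp Λ) :
    ω.expect (shiftSet (superlatVec q z) Λ) (fermionEmbed (PolySite.shiftEmb (superlatVec q z) Λ) A) = ω.expect Λ A := by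
  rw [← shift_expect, hω.shift_superlatVec]

end InfVolFermionState

namespace FermionInteraction

/-- **A `q`-PERIODIC INTERACTION**: covariant under the superlattice `L_q = ⊕_i (q_i+1)ℤ e_i`: `Ψ(X + ℓ) = Γ(τ_ℓ)(Ψ X)` for every superlattice
vector `ℓ` (decorated / multi-band-by-decoration models, z-periodic stackings, staggered fields). Translation-covariant interactions are
`q`-periodic for every `q`. [cite: ArakiMoriya2003, §1 assumption (IV) and §8] [cite: Israel1979, Thm. I.2.4] -/
def IsPeriodic (q : Fin d → ℕ) (Ψ : FermionInteraction d) : Prop :=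
  ∀ (z : Fin d → ℤ) (X : Finset (Site d)), Ψ.Φ (shiftSet (superlatVec q z) X) = fermionEmbed (PolySite.shiftEmb (superlatVec q z) X) (Ψ.Φ X)

/-- Translation-covariant interactions are periodic under every superlattice. [cite: ArakiMoriya2003, §1 assumption (IV)] -/
theorem IsTranslationInvariant.isPeriodic {Ψ : FermionInteraction d} (hT : Ψ.IsTranslationInvariant) (q : Fin d → ℕ) : Ψ.IsPeriodic q :=
  fun z X => hT (superlatVec q z) X

end FermionInteraction

namespace InfVolFermionState

variable {q : Fin d → ℕ} {Ψ : FermionInteraction d} {ω : InfVolFermionState d}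

/-- Congruence of term energies along an equality of regions. [cite: ArakiMoriya2003, §4.1 Def. 4.5] -/
theorem expect_apply_congr (ω : InfVolFermionState d) (Ψ : FermionInteraction d) {S T : Finset (Site d)} (h : S = T) :
    ω.expect S (Ψ.Φ S) = ω.expect T (Ψ.Φ T) := by subst h; rfl

/-- **Superlattice invariance of the term energies**: `ω(Ψ(X + ℓ)) = ω(Ψ X)` for periodic `ω` and `Ψ` and a superlattice vector `ℓ`.
[cite: BratteliKishimotoRobinson1978, Thm. 2 (ℤ^ν-invariant Φ and ω)] -/
theorem IsPeriodic.expect_apply_shiftSet_superlatVec (hω : ω.IsPeriodic q) (hΨ : Ψ.IsPeriodic q) (z : Fin d → ℤ) (X : Finset (Site d)) :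
    ω.expect (shiftSet (superlatVec q z) X) (Ψ.Φ (shiftSet (superlatVec q z) X)) = ω.expect X (Ψ.Φ X) := by
  rw [hΨ z X, hω.expect_shiftSet_superlatVec]

/-! ### §2. Site energies and the generic free-boundary bookkeeping -/

variable (Ψ) (ω) in
/-- **The site energy** `ε(x) = Σ_{Y ∋ x, Y ⊆ thicken{x} R} |Y|⁻¹ ω_Y(Ψ Y)`: the share of the site `x` in the interaction energy (every term
is split equally among its sites). For translation-invariant data this is `ω(E_Ψ)` at every site. [cite: BratteliRobinsonII1997, §6.2.4 (mean energy)] -/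
def siteEnergy (R : ℝ) (x : Site d) : ℂ :=
  ∑ Y ∈ (thicken ({x} : Finset (Site d)) R).powerset with x ∈ Y, ((Y.card : ℂ)⁻¹ * ω.expect Y (Ψ.Φ Y))

/-- Unfolding. [cite: BratteliRobinsonII1997, §6.2.4] -/
theorem siteEnergy_apply (R : ℝ) (x : Site d) :
    siteEnergy Ψ ω R x = ∑ Y ∈ (thicken ({x} : Finset (Site d)) R).powerset with x ∈ Y, ((Y.card : ℂ)⁻¹ * ω.expect Y (Ψ.Φ Y)) := rfl

/-- **For translation-invariant data the site energy is the mean energy** `ω(E_Ψ)` at every site. [cite: BratteliRobinsonII1997, §6.2.4 (mean energy)] -/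
theorem IsTranslationInvariant.siteEnergy_eq {R : ℝ} (hω : ω.IsTranslationInvariant) (hT : Ψ.IsTranslationInvariant) (hR : Ψ.HasFiniteRange R)
    (x : Site d) : siteEnergy Ψ ω R x = ω.expect _ (Ψ.meanEnergyObs R) :=
  hω.sum_filter_mem_card_inv_mul_expect_eq hT hR subset_rfl

/-- The site energy re-rooted at the origin: `ε(x) = Σ_{X ∋ 0, X ⊆ thicken{0} R} |X|⁻¹ ω(Ψ(X + x))`. [cite: BratteliRobinsonII1997, §6.2.1] -/
theorem siteEnergy_eq_sum_shiftSet (R : ℝ) (x : Site d) :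
    siteEnergy Ψ ω R x = ∑ X ∈ (thicken ({0} : Finset (Site d)) R).powerset with (0 : Site d) ∈ X,
      (((shiftSet x X).card : ℂ)⁻¹ * ω.expect (shiftSet x X) (Ψ.Φ (shiftSet x X))) :=
  sum_thicken_singleton_eq_sum_shiftSet (fun Y => (Y.card : ℂ)⁻¹ * ω.expect Y (Ψ.Φ Y)) x R

/-- **Site energies of periodic data are superlattice periodic**: `ε(x + ℓ) = ε(x)`. [cite: ArakiMoriya2003, §4.1 Def. 4.5] -/
theorem IsPeriodic.siteEnergy_add_superlatVec (hω : ω.IsPeriodic q) (hΨ : Ψ.IsPeriodic q) (R : ℝ) (x : Site d) (z : Fin d → ℤ) :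
    siteEnergy Ψ ω R (x + superlatVec q z) = siteEnergy Ψ ω R x := by
  rw [siteEnergy_eq_sum_shiftSet, siteEnergy_eq_sum_shiftSet]
  refine Finset.sum_congr rfl fun X _ => ?_
  rw [card_shiftSet, card_shiftSet, ← shiftSet_shiftSet'' x (superlatVec q z) X,
    ω.expect_apply_congr Ψ rfl, hω.expect_apply_shiftSet_superlatVec hΨ]

/-- **Each site energy is bounded by the uniform site norm**: if `Σ_{X ∋ x, X ⊆ thicken{x} R} ‖Ψ X‖ ≤ S` then `‖ε(x)‖ ≤ S`.
[cite: BratteliRobinsonI1987, Prop. 2.3.11 (states are contractive)] -/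
theorem norm_siteEnergy_le {R S : ℝ} {x : Site d}
    (hS : ∑ X ∈ (thicken ({x} : Finset (Site d)) R).powerset with x ∈ X, ‖Ψ.Φ X‖ ≤ S) : ‖siteEnergy Ψ ω R x‖ ≤ S := by
  refine (norm_sum_le _ _).trans (le_trans (Finset.sum_le_sum fun Y hY => ?_) hS)
  rw [Finset.mem_filter] at hY
  have hne : Y.Nonempty := ⟨x, hY.2⟩
  have hc : (1 : ℝ) ≤ Y.card := by exact_mod_cast hne.card_pos
  rw [norm_mul, norm_inv, Complex.norm_natCast]
  calc (Y.card : ℝ)⁻¹ * ‖ω.expect Y (Ψ.Φ Y)‖ ≤ 1 * ‖Ψ.Φ Y‖ :=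
        mul_le_mul (inv_le_one_of_one_le₀ hc) (ω.norm_expect_le Y (Ψ.Φ Y)) (norm_nonneg _) zero_le_one
    _ = ‖Ψ.Φ Y‖ := one_mul _

variable (ω Ψ) in
/-- **THE GENERIC BOOKKEEPING IDENTITY** (every state, every interaction of finite range `R`, every finite `Λ`):
`Σ_{x ∈ Λ} ε(x) − (ω(H_Λ) − ω(Ψ∅)) = Σ_{Y ⊆ thicken_R Λ, Y ⊄ Λ} |Y ∩ Λ|·|Y|⁻¹ ω(Ψ Y)` — the only discrepancy between the sum of the site energies
and the free-boundary Hamiltonian comes from the terms straddling `∂Λ`. [cite: BratteliRobinsonII1997, §6.2.4 (Prop. 6.2.39 ff.)]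
[cite: BratteliKishimotoRobinson1978, §3 (H̃_Φ(Λ), W_Φ(Λ), p. 47)] -/
theorem sum_siteEnergy_sub_eq {R : ℝ} (hR : Ψ.HasFiniteRange R) (Λ : Finset (Site d)) :
    ∑ x ∈ Λ, siteEnergy Ψ ω R x - (ω.expect Λ (Ψ.localHamiltonian Λ) - ω.expect ∅ (Ψ.Φ ∅)) =
      ∑ Y ∈ (thicken Λ R).powerset with ¬ Y ⊆ Λ, ((Y ∩ Λ).card : ℂ) * ((Y.card : ℂ)⁻¹ * ω.expect Y (Ψ.Φ Y)) := by
  -- restrict each rooted sum to `thicken Λ R` and double count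
  have h1 : ∑ x ∈ Λ, siteEnergy Ψ ω R x =
      ∑ Y ∈ (thicken Λ R).powerset, ((Y ∩ Λ).card : ℂ) * ((Y.card : ℂ)⁻¹ * ω.expect Y (Ψ.Φ Y)) := by
    have h0 : ∑ x ∈ Λ, siteEnergy Ψ ω R x =
        ∑ x ∈ Λ, ∑ Y ∈ (thicken Λ R).powerset with x ∈ Y, ((Y.card : ℂ)⁻¹ * ω.expect Y (Ψ.Φ Y)) :=
      Finset.sum_congr rfl fun x hx => by
        rw [siteEnergy_apply]
        exact (hR.sum_filter_mem_eq_sum_thicken_singleton (fun Y => (Y.card : ℂ)⁻¹ * ω.expect Y (Ψ.Φ Y))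
          (fun Y hY => by rw [hY, map_zero, mul_zero]) (thicken_subset_thicken_of_subset (Finset.singleton_subset_iff.2 hx) R)).symm
    rw [h0, sum_sum_filter_mem_eq_sum_card_inter_smul]
    simp_rw [nsmul_eq_mul]
  rw [h1, ← Finset.sum_filter_add_sum_filter_not _ (fun Y => Y ⊆ Λ)]
  have hfilter : (thicken Λ R).powerset.filter (fun Y => Y ⊆ Λ) = Λ.powerset := by
    ext X
    simp only [Finset.mem_filter, Finset.mem_powerset]
    exact ⟨fun h => h.2, fun h => ⟨h.trans (subset_thicken Λ R), h⟩⟩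
  have hA : ∑ Y ∈ (thicken Λ R).powerset with Y ⊆ Λ, ((Y ∩ Λ).card : ℂ) * ((Y.card : ℂ)⁻¹ * ω.expect Y (Ψ.Φ Y)) =
      ω.expect Λ (Ψ.localHamiltonian Λ) - ω.expect ∅ (Ψ.Φ ∅) := by
    rw [hfilter, expect_localHamiltonian_eq_sum]
    have hdiff : ∑ Y ∈ Λ.powerset, (ω.expect Y (Ψ.Φ Y) - ((Y ∩ Λ).card : ℂ) * ((Y.card : ℂ)⁻¹ * ω.expect Y (Ψ.Φ Y))) =
        ω.expect ∅ (Ψ.Φ ∅) - (((∅ : Finset (Site d)) ∩ Λ).card : ℂ) * ((((∅ : Finset (Site d))).card : ℂ)⁻¹ * ω.expect ∅ (Ψ.Φ ∅)) := by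
      refine Finset.sum_eq_single_of_mem _ (Finset.empty_mem_powerset Λ) fun Y hY hne => ?_
      rw [Finset.mem_powerset] at hY
      have hc : (Y.card : ℂ) ≠ 0 := Nat.cast_ne_zero.2 (Finset.card_ne_zero.2 (Finset.nonempty_iff_ne_empty.2 hne))
      rw [Finset.inter_eq_left.2 hY, mul_inv_cancel_left₀ hc, sub_self]
    rw [Finset.empty_inter, Finset.card_empty, Nat.cast_zero, zero_mul, sub_zero, Finset.sum_sub_distrib] at hdiff
    rw [← hdiff]
    abel
  rw [hA]
  abel

variable (Ψ) in
/-- **Collar bound under a uniform site norm**: if `Σ_{X ∋ y, X ⊆ thicken{y} R} ‖Ψ X‖ ≤ S` for every site `y`, then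
`Σ_{X ⊆ thicken_R Λ, X ⊄ Λ} ‖Ψ X‖ ≤ |thicken_R Λ ∖ Λ| · S`. [cite: BratteliKishimotoRobinson1978, §3 (surface energy W_Φ(Λ), p. 47)] -/
theorem sum_filter_not_subset_norm_le_of_site {R S : ℝ} (hR : Ψ.HasFiniteRange R)
    (hS : ∀ y : Site d, ∑ X ∈ (thicken ({y} : Finset (Site d)) R).powerset with y ∈ X, ‖Ψ.Φ X‖ ≤ S) (Λ : Finset (Site d)) :
    ∑ X ∈ (thicken Λ R).powerset with ¬ X ⊆ Λ, ‖Ψ.Φ X‖ ≤ ((thicken Λ R \ Λ).card : ℝ) * S := by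
  refine (sum_filter_not_subset_le_sum_sdiff_sum Λ (thicken Λ R) (fun X => ‖Ψ.Φ X‖) fun _ => norm_nonneg _).trans ?_
  have hsite : ∀ y ∈ thicken Λ R \ Λ, ∑ X ∈ (thicken Λ R).powerset with y ∈ X, ‖Ψ.Φ X‖ ≤ S := by
    intro y _
    calc ∑ X ∈ (thicken Λ R).powerset with y ∈ X, ‖Ψ.Φ X‖
        ≤ ∑ X ∈ (thicken Λ R ∪ thicken ({y} : Finset (Site d)) R).powerset with y ∈ X, ‖Ψ.Φ X‖ :=
          Finset.sum_le_sum_of_subset_of_nonneg (Finset.filter_subset_filter _ (Finset.powerset_mono.2 Finset.subset_union_left))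
            fun _ _ _ => norm_nonneg _
      _ = ∑ X ∈ (thicken ({y} : Finset (Site d)) R).powerset with y ∈ X, ‖Ψ.Φ X‖ :=
          hR.sum_filter_mem_eq_sum_thicken_singleton _ (fun X hX => by rw [hX, norm_zero]) Finset.subset_union_right
      _ ≤ S := hS y
  refine (Finset.sum_le_sum hsite).trans ?_
  rw [Finset.sum_const, nsmul_eq_mul]

variable (ω Ψ) in
/-- **THE GENERIC ENERGY ESTIMATE**: `‖Σ_{x∈Λ} ε(x) − (ω(H_Λ) − ω(Ψ∅))‖ ≤ |thicken_R Λ ∖ Λ| · S` for EVERY state and every interaction of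
finite range `R` with uniform site norm `≤ S`. [cite: BratteliRobinsonII1997, §6.2.4 (Prop. 6.2.39 ff.)] -/
theorem norm_sum_siteEnergy_sub_le {R S : ℝ} (hR : Ψ.HasFiniteRange R)
    (hS : ∀ y : Site d, ∑ X ∈ (thicken ({y} : Finset (Site d)) R).powerset with y ∈ X, ‖Ψ.Φ X‖ ≤ S) (Λ : Finset (Site d)) :
    ‖∑ x ∈ Λ, siteEnergy Ψ ω R x - (ω.expect Λ (Ψ.localHamiltonian Λ) - ω.expect ∅ (Ψ.Φ ∅))‖ ≤ ((thicken Λ R \ Λ).card : ℝ) * S := by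
  rw [ω.sum_siteEnergy_sub_eq Ψ hR Λ]
  exact (ω.norm_sum_filter_not_subset_le Ψ Λ _).trans (sum_filter_not_subset_norm_le_of_site Ψ hR hS Λ)

/-- For a translation-covariant interaction the uniform site norm is the tree's `S_Ψ = Σ_{X ∋ 0, X ⊆ thicken{0} R} ‖Ψ X‖`.
[cite: BratteliRobinsonII1997, §6.2.4 (the norm Σ_{X∋0} ‖Φ(X)‖)] -/
theorem _root_.Literature.MathematicalPhysics.QuantumLattice.FermionInteraction.IsTranslationInvariant.site_norm_le {R : ℝ}
    (hT : Ψ.IsTranslationInvariant) (hR : Ψ.HasFiniteRange R) (y : Site d) :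
    ∑ X ∈ (thicken ({y} : Finset (Site d)) R).powerset with y ∈ X, ‖Ψ.Φ X‖ ≤
      ∑ X ∈ (thicken ({0} : Finset (Site d)) R).powerset with (0 : Site d) ∈ X, ‖Ψ.Φ X‖ :=
  hT.sum_filter_mem_norm_le hR y _

/-- **Periodic interactions have a uniform site norm**: the maximum over the cell, `S_q(Ψ) = max_{c ∈ C} Σ_{X ∋ pos c, …} ‖Ψ X‖`, bounds the
site norm at every site. [cite: ArakiMoriya2003, §5.4 (finite range potentials)] -/
theorem _root_.Literature.MathematicalPhysics.QuantumLattice.FermionInteraction.IsPeriodic.site_norm_le {R : ℝ} (hΨ : Ψ.IsPeriodic q)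
    (y : Site d) :
    ∑ X ∈ (thicken ({y} : Finset (Site d)) R).powerset with y ∈ X, ‖Ψ.Φ X‖ ≤
      Finset.univ.sup' Finset.univ_nonempty fun c : Cell q =>
        ∑ X ∈ (thicken ({cellPos c} : Finset (Site d)) R).powerset with cellPos c ∈ X, ‖Ψ.Φ X‖ := by
  -- write `y = pos c + ℓ` with `c` the residue of `y` modulo the periods
  have hper : ∀ i, (0 : ℤ) < (q i : ℤ) + 1 := fun i => by positivity
  set c : Cell q := fun i => ⟨(y i % ((q i : ℤ) + 1)).toNat, by
    have h1 := Int.emod_nonneg (y i) (hper i).ne'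
    have h2 := Int.emod_lt_of_pos (y i) (hper i)
    omega⟩ with hc
  set z : Fin d → ℤ := fun i => y i / ((q i : ℤ) + 1) with hz
  have hy : y = cellPos c + superlatVec q z := by
    funext i
    simp only [Pi.add_apply, cellPos, superlatVec_apply, hc, hz]
    have h1 := Int.emod_nonneg (y i) (hper i).ne'
    rw [Int.toNat_of_nonneg h1]
    have := Int.emod_add_mul_ediv (y i) ((q i : ℤ) + 1)
    linarith [mul_comm ((q i : ℤ) + 1) (y i / ((q i : ℤ) + 1))]
  -- the site norm at `y` is at most the site norm at `pos c` (`Γ(τ_ℓ)` is norm-contractive)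
  have hle : ∑ X ∈ (thicken ({y} : Finset (Site d)) R).powerset with y ∈ X, ‖Ψ.Φ X‖ ≤
      ∑ X ∈ (thicken ({cellPos c} : Finset (Site d)) R).powerset with cellPos c ∈ X, ‖Ψ.Φ X‖ := by
    rw [sum_thicken_singleton_eq_sum_shiftSet (fun X => ‖Ψ.Φ X‖) y R,
      sum_thicken_singleton_eq_sum_shiftSet (fun X => ‖Ψ.Φ X‖) (cellPos c) R]
    refine Finset.sum_le_sum fun X _ => ?_
    rw [hy, ← shiftSet_shiftSet'' (cellPos c) (superlatVec q z) X, hΨ z]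
    exact norm_fermionEmbed_le _ _
  exact hle.trans (Finset.le_sup' (fun c : Cell q =>
    ∑ X ∈ (thicken ({cellPos c} : Finset (Site d)) R).powerset with cellPos c ∈ X, ‖Ψ.Φ X‖) (Finset.mem_univ c))

/-! ### §3. The cell energy density and aligned boxes -/

variable (q Ψ ω) in
/-- **The cell energy density** `ē(ω) = |C|⁻¹ Σ_{c ∈ C} Re ε(pos c)`: the energy per site of the (periodic) state in the (periodic) interaction,
averaged over the fundamental cell. [cite: BratteliRobinsonII1997, §6.2.4 (mean energy)] [cite: Israel1979, Thm. I.2.4] -/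
def cellMeanEnergy (R : ℝ) : ℝ := (Fintype.card (Cell q) : ℝ)⁻¹ * ∑ c : Cell q, (siteEnergy Ψ ω R (cellPos c)).re

/-- **For a translation-covariant interaction the site energy is the mean energy of the translated state**: `ε(x) = (ω ∘ τ_x)(E_Ψ)`.
[cite: BratteliKishimotoRobinson1978, §3 (mean energy functional)] -/
theorem siteEnergy_eq_expect_shift_meanEnergyObs {R : ℝ} (hT : Ψ.IsTranslationInvariant) (x : Site d) :
    siteEnergy Ψ ω R x = (ω.shift x).expect _ (Ψ.meanEnergyObs R) := by
  rw [siteEnergy_eq_sum_shiftSet, KrausPattern.expect_meanEnergyObs]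
  refine Finset.sum_congr rfl fun X _ => ?_
  rw [card_shiftSet, hT x X, shift_expect]

/-- **For a translation-covariant interaction the cell energy density is the mean energy of the cell average** (any state).
[cite: BratteliKishimotoRobinson1978, §3 (mean energy functional)] -/
theorem cellMeanEnergy_eq_meanEnergy_cellAverage {R : ℝ} (hT : Ψ.IsTranslationInvariant) :
    cellMeanEnergy q Ψ ω R = (ω.cellAverage q).meanEnergy Ψ R := by
  rw [cellMeanEnergy, meanEnergy_cellAverage]
  congr 1
  refine Finset.sum_congr rfl fun c _ => ?_
  rw [siteEnergy_eq_expect_shift_meanEnergyObs hT, meanEnergy]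

/-- For translation-invariant state AND interaction the cell energy density is the mean energy. [cite: BratteliKishimotoRobinson1978, §3] -/
theorem IsTranslationInvariant.cellMeanEnergy_eq {R : ℝ} (hω : ω.IsTranslationInvariant) (hT : Ψ.IsTranslationInvariant) :
    cellMeanEnergy q Ψ ω R = ω.meanEnergy Ψ R := by
  rw [cellMeanEnergy_eq_meanEnergy_cellAverage hT]
  show (ω.shiftAverage _).meanEnergy Ψ R = _
  rw [hω.shiftAverage_eq]

/-- `|ē(ω)| ≤ S` under a uniform site norm `S`. [cite: BratteliRobinsonI1987, Prop. 2.3.11] -/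
theorem abs_cellMeanEnergy_le {R S : ℝ}
    (hS : ∀ y : Site d, ∑ X ∈ (thicken ({y} : Finset (Site d)) R).powerset with y ∈ X, ‖Ψ.Φ X‖ ≤ S) :
    |cellMeanEnergy q Ψ ω R| ≤ S := by
  have hN : (0 : ℝ) < Fintype.card (Cell q) := by exact_mod_cast Fintype.card_pos
  rw [cellMeanEnergy, abs_mul, abs_of_pos (inv_pos.2 hN), ← div_eq_inv_mul, div_le_iff₀ hN]
  calc |∑ c : Cell q, (siteEnergy Ψ ω R (cellPos c)).re| ≤ ∑ c : Cell q, |(siteEnergy Ψ ω R (cellPos c)).re| :=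
        Finset.abs_sum_le_sum_abs _ _
    _ ≤ ∑ _c : Cell q, S := Finset.sum_le_sum fun c _ =>
        (Complex.abs_re_le_norm _).trans (norm_siteEnergy_le (hS _))
    _ = S * Fintype.card (Cell q) := by rw [Finset.sum_const, Finset.card_univ, nsmul_eq_mul, mul_comm]

/-- The residue of a site modulo the periods, a point of the cell. [cite: ArakiMoriya2003, §4.1] -/
def cellRes (q : Fin d → ℕ) (x : Site d) : Cell q := fun i =>
  ⟨(x i % ((q i : ℤ) + 1)).toNat, by
    have h0 : (0 : ℤ) < (q i : ℤ) + 1 := by positivity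
    have h1 := Int.emod_nonneg (x i) h0.ne'
    have h2 := Int.emod_lt_of_pos (x i) h0
    omega⟩

/-- Every site is its residue plus a superlattice vector: `x = pos(res x) + superlatVec(x div periods)`. [cite: ArakiMoriya2003, §4.1] -/
theorem eq_cellPos_cellRes_add_superlatVec (q : Fin d → ℕ) (x : Site d) :
    x = cellPos (cellRes q x) + superlatVec q (fun i => x i / ((q i : ℤ) + 1)) := by
  funext i
  have h0 : (0 : ℤ) < (q i : ℤ) + 1 := by positivity
  simp only [Pi.add_apply, cellPos, cellRes, superlatVec_apply]
  rw [Int.toNat_of_nonneg (Int.emod_nonneg (x i) h0.ne')]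
  have := Int.emod_add_mul_ediv (x i) ((q i : ℤ) + 1)
  linarith [mul_comm ((q i : ℤ) + 1) (x i / ((q i : ℤ) + 1))]

/-- **Site energies of periodic data depend only on the residue**: `ε(x) = ε(pos(res x))`. [cite: ArakiMoriya2003, §4.1 Def. 4.5] -/
theorem IsPeriodic.siteEnergy_eq_siteEnergy_cellRes (hω : ω.IsPeriodic q) (hΨ : Ψ.IsPeriodic q) (R : ℝ) (x : Site d) :
    siteEnergy Ψ ω R x = siteEnergy Ψ ω R (cellPos (cellRes q x)) := by
  conv_lhs => rw [eq_cellPos_cellRes_add_superlatVec q x]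
  exact hω.siteEnergy_add_superlatVec hΨ R _ _

/-- **Counting residues in an aligned box**: for `(q_i+1) ∣ n`, the sites of `[0,n)^d` with residue `c` number `Π_i n/(q_i+1)`.
[cite: ArakiMoriya2003, §4.1] -/
theorem card_filter_halfOpenBox_cellRes_eq (q : Fin d → ℕ) {n : ℕ} (hn : ∀ i, (q i + 1) ∣ n) (c : Cell q) :
    ((halfOpenBox d n).filter fun x => cellRes q x = c).card = ∏ i, (n / (q i + 1)) := by
  classical
  -- bijection with `Π_i [0, n/(q_i+1))`: `x ↦ (x_i div (q_i+1))_i`, inverse `k ↦ (c_i + (q_i+1) k_i)_i`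
  have hcard : (Fintype.piFinset fun i : Fin d => Finset.range (n / (q i + 1))).card = ∏ i, (n / (q i + 1)) := by
    rw [Fintype.card_piFinset]; simp only [Finset.card_range]
  rw [← hcard]
  rw [← Finset.card_map ⟨(fun k : Fin d → ℕ => fun i => ((c i : ℕ) : ℤ) + ((q i : ℤ) + 1) * k i), fun k k' h => by
    funext i
    have hi := congrFun h i
    have h0 : (0 : ℤ) < (q i : ℤ) + 1 := by positivity
    simp only at hi
    have := mul_left_cancel₀ h0.ne' (add_left_cancel hi)
    exact_mod_cast this⟩]
  congr 1
  ext x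
  simp only [Finset.mem_filter, mem_halfOpenBox, Finset.mem_map, Fintype.mem_piFinset, Finset.mem_range, Function.Embedding.coeFn_mk]
  constructor
  · rintro ⟨hx, hres⟩
    refine ⟨fun i => (x i / ((q i : ℤ) + 1)).toNat, fun i => ?_, ?_⟩
    · have h0 : (0 : ℤ) < (q i : ℤ) + 1 := by positivity
      obtain ⟨m, hm⟩ := hn i
      have hq : n / (q i + 1) = m := by rw [hm, Nat.mul_div_cancel_left m (Nat.succ_pos _)]
      rw [hq]
      have hxi := hx i
      have hdiv : 0 ≤ x i / ((q i : ℤ) + 1) := Int.ediv_nonneg hxi.1 h0.le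
      have hn' : (n : ℤ) = ((q i : ℤ) + 1) * m := by rw [hm]; push_cast; ring
      have hlt : x i / ((q i : ℤ) + 1) < m :=
        (Int.ediv_lt_iff_lt_mul h0).2 (by rw [mul_comm]; linarith [hxi.2])
      show (x i / ((q i : ℤ) + 1)).toNat < m
      omega
    · funext i
      have h := congrFun (eq_cellPos_cellRes_add_superlatVec q x) i
      rw [hres] at h
      simp only [Pi.add_apply, cellPos, superlatVec_apply] at h
      have h0 : (0 : ℤ) < (q i : ℤ) + 1 := by positivity
      have hdiv : 0 ≤ x i / ((q i : ℤ) + 1) := Int.ediv_nonneg (hx i).1 h0.le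
      rw [Int.toNat_of_nonneg hdiv]
      linarith
  · rintro ⟨k, hk, rfl⟩
    have hc : ∀ i, ((c i : ℕ) : ℤ) < (q i : ℤ) + 1 := fun i => by exact_mod_cast (c i).isLt
    constructor
    · intro i
      have h0 : (0 : ℤ) < (q i : ℤ) + 1 := by positivity
      obtain ⟨m, hm⟩ := hn i
      have hki : (k i : ℤ) + 1 ≤ (n / (q i + 1) : ℕ) := by exact_mod_cast hk i
      rw [hm, Nat.mul_div_cancel_left m (Nat.succ_pos _)] at hki
      constructor
      · positivity
      · push_cast [hm]; nlinarith [hc i]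
    · funext i
      apply Fin.ext
      simp only [cellRes]
      have h0 : (0 : ℤ) < (q i : ℤ) + 1 := by positivity
      rw [Int.add_mul_emod_self_left, Int.emod_eq_of_lt (by positivity) (hc i), Int.toNat_natCast]

/-- `Π_i n/(q_i+1) · |C| = n^d` for `(q_i+1) ∣ n`. [cite: ArakiMoriya2003, §4.1] -/
theorem prod_div_mul_card_cell (q : Fin d → ℕ) {n : ℕ} (hn : ∀ i, (q i + 1) ∣ n) :
    (∏ i, (n / (q i + 1))) * Fintype.card (Cell q) = n ^ d := by
  rw [Fintype.card_pi, ← Finset.prod_mul_distrib]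
  simp only [Fintype.card_fin]
  rw [Finset.prod_congr rfl fun i _ => Nat.div_mul_cancel (hn i), Finset.prod_const, Finset.card_univ, Fintype.card_fin]

/-- **Summing site energies over an aligned box**: for `q`-periodic `ω` and `Ψ` and `(q_i+1) ∣ n`,
`Σ_{x ∈ [0,n)^d} Re ε(x) = n^d · ē(ω)`. [cite: BratteliRobinsonII1997, §6.2.4 (mean energy)] -/
theorem IsPeriodic.sum_re_siteEnergy_halfOpenBox_eq (hω : ω.IsPeriodic q) (hΨ : Ψ.IsPeriodic q) (R : ℝ) {n : ℕ} (hn : ∀ i, (q i + 1) ∣ n) :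
    ∑ x ∈ halfOpenBox d n, (siteEnergy Ψ ω R x).re = (n : ℝ) ^ d * cellMeanEnergy q Ψ ω R := by
  classical
  have hN : (Fintype.card (Cell q) : ℝ) ≠ 0 := Nat.cast_ne_zero.2 Fintype.card_ne_zero
  rw [cellMeanEnergy, ← mul_assoc]
  rw [← Finset.sum_fiberwise_of_maps_to (s := halfOpenBox d n) (t := (Finset.univ : Finset (Cell q))) (g := cellRes q)
    (fun x _ => Finset.mem_univ _)]
  have hfib : ∀ c : Cell q, ∑ x ∈ (halfOpenBox d n).filter (fun x => cellRes q x = c), (siteEnergy Ψ ω R x).re =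
      (∏ i, (n / (q i + 1)) : ℕ) * (siteEnergy Ψ ω R (cellPos c)).re := by
    intro c
    rw [Finset.sum_congr rfl fun x hx => by rw [hω.siteEnergy_eq_siteEnergy_cellRes hΨ R x, (Finset.mem_filter.1 hx).2],
      Finset.sum_const, card_filter_halfOpenBox_cellRes_eq q hn c, nsmul_eq_mul]
  rw [Finset.sum_congr rfl fun c _ => hfib c, ← Finset.mul_sum]
  congr 1
  have h := prod_div_mul_card_cell q hn
  have h' : ((∏ i, (n / (q i + 1)) : ℕ) : ℝ) * (Fintype.card (Cell q) : ℝ) = (n : ℝ) ^ d := by exact_mod_cast h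
  field_simp
  linarith [h']

/-- **THE PERIODIC ENERGY BOOKKEEPING**: for `q`-periodic `ω` and `Ψ` (finite range `R`, uniform site norm `≤ S`) and an aligned box
`[0,n)^d` (`(q_i+1) ∣ n`): `|n^d ē(ω) − (Re ω(H_{[0,n)^d}) − Re (Ψ∅)_{∅∅})| ≤ |thicken_R([0,n)^d) ∖ [0,n)^d| · S`.
[cite: BratteliRobinsonII1997, §6.2.4 (Prop. 6.2.39 ff.)] [cite: BratteliKishimotoRobinson1978, §3 (H_Φ(ω) = lim ω(H_Φ(Λ))/|Λ|, p. 47)] -/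
theorem IsPeriodic.abs_pow_mul_cellMeanEnergy_sub_le (hω : ω.IsPeriodic q) (hΨ : Ψ.IsPeriodic q) {R S : ℝ} (hR : Ψ.HasFiniteRange R)
    (hS : ∀ y : Site d, ∑ X ∈ (thicken ({y} : Finset (Site d)) R).powerset with y ∈ X, ‖Ψ.Φ X‖ ≤ S) {n : ℕ} (hn : ∀ i, (q i + 1) ∣ n) :
    |(n : ℝ) ^ d * cellMeanEnergy q Ψ ω R -
        ((ω.expect (halfOpenBox d n) (Ψ.localHamiltonian (halfOpenBox d n))).re - ((Ψ.Φ ∅) ∅ ∅).re)| ≤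
      (((thicken (halfOpenBox d n) R \ halfOpenBox d n).card : ℝ)) * S := by
  have h := ω.norm_sum_siteEnergy_sub_le Ψ hR hS (halfOpenBox d n)
  rw [← hω.sum_re_siteEnergy_halfOpenBox_eq hΨ R hn, ← expect_empty_eq ω (Ψ.Φ ∅), ← Complex.re_sum]
  refine le_trans ?_ h
  rw [← Complex.sub_re, ← Complex.sub_re]
  exact Complex.abs_re_le_norm _

end InfVolFermionState

end Literature.MathematicalPhysics.QuantumLattice

end
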